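import Literature.Computability.Complexity.HashBricks
import Literature.Computability.Complexity.StackBricksArith
import Literature.Computability.Complexity.NSubexp
import HarnessLib

/-!
# Time-constructibility of `n + 2ⁿ / n` (the bound of Williams' nondeterministic simulation)

Literature / complexity toolkit, serving the decomposition of Williams' transfer theorem
(`Williams2014Transfer.lean`, hypothesis `IsTimeConstructible williamsBound` of
`Williams2014_lowerBound_of_accSat_of`, where `williamsBound n = n + 2 ^ n / n`). In the tree's
Sipser form (`Classes.lean`), `IsTimeConstructible t` asks `n ≤ t n` and a `TM2` machine mapping
`1ⁿ` to the binary numeral of `t n` within `c · t n + c` steps. For `t n = n + 2 ^ n / n`: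

* `Brick.idAddTwoPowDivFn` — the string function `1ⁿ ↦ bin (n + 2ⁿ / n)`, assembled from the
  tree's `FP` bricks: `HashBricks.popCountFn` (`1ⁿ ↦ bin n`, `HashBricks.lean`),
  `TimeConstructible.powFn 1` (`1ⁿ ↦ bin 2ⁿ`, `NSubexp.lean`), the quotient and sum bricks
  `divFn`, `addFn` (`StackBricksArith.lean`, `StackBricks.lean`) and `fanoutFn`/composition; it
  is in `FP` (`Brick.idAddTwoPowDivFn_mem_FP`) with the value `encodeNat (n + 2 ^ n / n)` on `1ⁿ`
  (`Brick.idAddTwoPowDivFn_unary`);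
* `exists_poly_le_id_add_two_pow_div` — every polynomial is `≤ c · (n + 2ⁿ / n) + c`;
* **`isTimeConstructible_id_add_two_pow_div : IsTimeConstructible fun n => n + 2 ^ n / n`**
  (Arora–Barak 2009, §1.3: the standard examples `n`, `n log n`, `n²`, `2ⁿ`; any function
  computable in time polynomial in `n` and eventually dominating every polynomial is time
  constructible in this sense).

No machine is written by hand. Mathlib has no time-constructibility notion; the tree's
`IsTimeConstructible`, `FP` and bricks are reused.

## References

* S. Arora, B. Barak, *Computational Complexity: A Modern Approach*, CUP 2009, §1.3 (p. 16,
  time-constructible functions), §3.1.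
* R. Williams, *Nonuniform ACC circuit lower bounds*, J. ACM 61 (2014), proof of Thm. 3.2
  (`NTIME[2ⁿ] ⊆ NTIME[o(2ⁿ)]` "contradicting the nondeterministic time hierarchy").
-/

namespace Literature.Computability.Complexity

open _root_.Computability Polynomial

namespace Brick

/-- The string function `1ⁿ ↦ bin (n + 2ⁿ / n)`: the sum brick applied to `⟨bin n, bin (2ⁿ / n)⟩`,
the quotient brick applied to `⟨bin 2ⁿ, bin n⟩`; `bin n` is the population count of the unary
input (`HashBricks.popCountFn`, `TimeConstructible.powFn 1`, `divFn`, `addFn`, `fanoutFn`).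
[folklore] -/
noncomputable def idAddTwoPowDivFn : List Bool → List Bool :=
  addFn ∘ fanoutFn HashBricks.popCountFn
    (divFn ∘ fanoutFn (TimeConstructible.powFn 1) HashBricks.popCountFn)

/-- `idAddTwoPowDivFn ∈ FP` (closure of `FP` under composition and fan-out).
[cite: AroraBarak2009, §1.3] -/
theorem idAddTwoPowDivFn_mem_FP : idAddTwoPowDivFn ∈ FP :=
  comp_mem_FP addFn_mem_FP (fanoutFn_mem_FP HashBricks.popCountFn_mem_FP
    (comp_mem_FP divFn_mem_FP
      (fanoutFn_mem_FP (TimeConstructible.powFn_mem_FP 1) HashBricks.popCountFn_mem_FP)))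

/-- The value on a unary input: `idAddTwoPowDivFn (1ⁿ) = bin (n + 2ⁿ / n)`. [folklore] -/
theorem idAddTwoPowDivFn_unary (n : ℕ) :
    idAddTwoPowDivFn (unaryEncodeNat n) = encodeNat (n + 2 ^ n / n) := by
  have hc : (unaryEncodeNat n).count true = n := by
    rw [OracleCompose.unaryEncodeNat_eq_replicate, List.count_replicate_self]
  simp only [idAddTwoPowDivFn, Function.comp_apply, fanoutFn_apply, HashBricks.popCountFn_apply,
    hc, TimeConstructible.powFn_unary, pow_one, divFn_boolPair, bitsToNat_encodeNat,
    addFn_boolPair]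

end Brick

/-- `n ↦ n + 2ⁿ / n` is polynomial-time computable from unary input to binary output. [folklore] -/
theorem polyTimeComputable_id_add_two_pow_div :
    PolyTimeComputable unaryEncodeNat encodeNat (fun n : ℕ => n + 2 ^ n / n) := by
  have h : PolyTimeComputable id id Brick.idAddTwoPowDivFn := Brick.idAddTwoPowDivFn_mem_FP
  obtain ⟨p, M, hM⟩ := h
  refine ⟨p, M, fun n => ?_⟩
  have h1 := hM (unaryEncodeNat n)
  dsimp only at h1 ⊢
  rw [Brick.idAddTwoPowDivFn_unary] at h1
  exact h1

/-- `nᵈ ≤ C · (2ⁿ / n) + C` for a constant `C = C(d)` (from `n^{d+1} ≤ C · 2ⁿ`). [folklore] -/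
theorem exists_pow_le_mul_two_pow_div (d : ℕ) : ∃ C : ℕ, ∀ n : ℕ, n ^ d ≤ C * (2 ^ n / n) + C := by
  obtain ⟨C, hC⟩ := TimeConstructible.exists_pow_le_mul_two_pow (d + 1)
  refine ⟨C, fun n => ?_⟩
  rcases Nat.eq_zero_or_pos n with rfl | hn
  · have hC1 : 1 ≤ C := by
      have := hC 1
      simp at this
      omega
    cases d with
    | zero => simpa using hC1
    | succ d => simp
  · -- `nᵈ ≤ (C · 2ⁿ) / n ≤ C · (2ⁿ / n) + C`
    have h1 : n ^ d ≤ C * 2 ^ n / n := by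
      rw [Nat.le_div_iff_mul_le hn, ← pow_succ]
      exact hC n
    have h2 : C * 2 ^ n / n ≤ C * (2 ^ n / n) + C := by
      have hqr : n * (2 ^ n / n) + 2 ^ n % n = 2 ^ n := Nat.div_add_mod (2 ^ n) n
      have hr : 2 ^ n % n < n := Nat.mod_lt _ hn
      have hrw : C * 2 ^ n = n * (C * (2 ^ n / n)) + C * (2 ^ n % n) := by
        conv_lhs => rw [← hqr]
        ring
      rw [hrw, Nat.mul_add_div hn]
      refine Nat.add_le_add_left (Nat.div_le_of_le_mul ?_) _
      calc C * (2 ^ n % n) ≤ C * n := Nat.mul_le_mul_left C hr.le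
        _ = n * C := Nat.mul_comm _ _
    exact h1.trans h2

/-- Every polynomial is dominated by `c · (n + 2ⁿ / n) + c`. [folklore] -/
theorem exists_poly_le_id_add_two_pow_div (p : Polynomial ℕ) :
    ∃ c : ℕ, ∀ n : ℕ, p.eval n ≤ c * (n + 2 ^ n / n) + c := by
  obtain ⟨c₁, d, h₁⟩ := exists_eval_le_mul_pow_add p
  obtain ⟨C, hC⟩ := exists_pow_le_mul_two_pow_div d
  refine ⟨c₁ * C + c₁, fun n => ?_⟩
  calc p.eval n ≤ c₁ * n ^ d + c₁ := h₁ n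
    _ ≤ c₁ * (C * (2 ^ n / n) + C) + c₁ := by gcongr; exact hC n
    _ = (c₁ * C) * (2 ^ n / n) + (c₁ * C + c₁) := by ring
    _ ≤ (c₁ * C + c₁) * (n + 2 ^ n / n) + (c₁ * C + c₁) := by gcongr <;> omega

/-- **`n + 2ⁿ / n` is time constructible** in the tree's Sipser form: `n ≤ n + 2ⁿ / n`, and
`1ⁿ ↦ bin (n + 2ⁿ / n)` is computed by the polynomial-time machine of `Brick.idAddTwoPowDivFn`,
whose running time is `≤ c · (n + 2ⁿ / n) + c` (Arora–Barak 2009, §1.3: a function computable in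
time `O(T(n))` from `1ⁿ` with `T(n) ≥ n` is time constructible; here the computation is even
polynomial-time). This is the bound `williamsBound` of `Williams2014Transfer.lean`.
[cite: AroraBarak2009, §1.3 (p. 16)] -/
theorem isTimeConstructible_id_add_two_pow_div :
    IsTimeConstructible fun n => n + 2 ^ n / n := by
  refine ⟨fun n => Nat.le_add_right n _, ?_⟩
  obtain ⟨p, M, hM⟩ := polyTimeComputable_id_add_two_pow_div
  obtain ⟨c, hc⟩ := exists_poly_le_id_add_two_pow_div p
  refine ⟨c, M, fun n => (hM n).mono ?_⟩
  have hl : (unaryEncodeNat n).length = n := by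
    rw [OracleCompose.unaryEncodeNat_eq_replicate, List.length_replicate]
  simp only [hl]
  exact hc n

end Literature.Computability.Complexity
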